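import Summits.QuantumFields.YangMills.Theorems.SwapVirialDeficitGnomonicJetFourLeaders
import HarnessLib

/-!
# W4 (order-4 jets), part K7a: JETS ALONG ARBITRARY AFFINE LINES OF THE GNOMONIC CHART (not only the Euler rays)
# (free-hands support of ⟨stmt-QuantumFields-24197⟩ `SwapVirialDeficit.SwapGluedStiffness`)

LEAD g97's steep-window Morse–Bott plan needs Taylor data not only along the Euler rays through the axial point (K1–K6) but along GENERAL segments of the
gnomonic chart: (T1) the Taylor floor at the follower MINIMISER along segments of the sup-box, (T2) the Lipschitz dependence of the fibre Hessian on the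
base point (third derivatives along base segments), and the polarisation of ray jets into multilinear bounds (W3).  The order-4 package of K1 ∕ K2
(✓`jet4_radialUnit_affine`: the radial projection of `u₀ + t w`, `w ⊥ u₀`, carries a 4-jet of size `‖w‖/‖u₀‖`) extends to every affine line avoiding the origin
by a TRANSLATION of the parameter (`u₀ + sw = u₀′ + (s − s₀)w`, `u₀′ = u₀ − (⟪u₀,w⟫/‖w‖²)w ⊥ w` the foot of the perpendicular):
* §1 ★★ `jet4_radialUnit_line` — `s ↦ radialUnit (u₀ + s • w)` carries a 4-jet of size `‖w‖/‖u₀′‖` whenever the foot `u₀′ ≠ 0`;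
* §2 ★★ `jet4_gnoLetterLine` — for gnomonic letters the line `s ↦ ±(1, v + s ξ)` has constant real part `±1`, so `‖u₀′‖ ≥ 1` and
  `s ↦ su2Quat (quatToSU2 (gnoLetter ε (v + s • ξ)))` carries a 4-jet of size `√(Σ ξᵢ²)` — EVERY base point `v`, EVERY direction `ξ` (`one_le_norm_foot`,
  `foot_ne_zero`, `gnomonicQuat_add_smul`);
* §3 ★★★ `jet4_leader_line` ∕ `jet4_follower_line` — along `s ↦ blowUpPoint 1 (gnomonicPoint a ε (η + s • ξ))` (`a ≠ 0`; `GnoCoord L` is a real vector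
  space) every leader carries a 4-jet of size `√Σ(ξ.1.1)² + √Σ(ξ.1.2)² + √Σ(ξ.2.1)²` and the follower `i` one of size `√Σ(ξ.2.2 i)²`.
Part K7b feeds these to ✓`jet4_fixHistory` ∕ ✓`realJet4_qDeficit_le` (generic in the letter families) and packages the Taylor data of
`s ↦ F̂(η + s ξ)` at every `η` in every direction `ξ`: the deficit is `C⁴`-bounded on the whole gnomonic chart with polynomial constants.

HONEST LABEL: calculus plumbing (no measure); nothing about ⟨24197⟩ (window-uniform, OPEN), (LW), (M), W3∕W5–W9 or any rung is proved; ⟨24194⟩ ∕ ⟨24196⟩ ∕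
⟨24497⟩ OPEN; item of record ⟨24085⟩ SubOctaveBounded aside ∕ untouched; the Yang–Mills mass gap is NOT proved; no summit is proved by a line.  THEOREMS ONLY
(0 `def`, 0 `sorry`), standard axioms, no local instances.  Seat ym-line-fcl-p3 g47 (cell ym-idea-1, free hands), `--supports stmt-QuantumFields-24197`.
References: [folklore].
-/

set_option autoImplicit false

noncomputable section

open Quaternion
open scoped Quaternion RealInnerProductSpace BigOperators
open Literature.MathematicalPhysics.QuantumLattice
open Literature.Analysis.Calculus (radialUnit radialUnit_def norm_radialUnit)
open Summit.QuantumFields.YangMills.Theorems.SwapTwistDeficit.ToronLog (axisPoint)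
open Summit.QuantumFields.YangMills.Theorems.SwapVirialDeficit.ZeroModeSigma (su2Quat_quatToSU2_eq_radialUnit slaveP norm_axisUnit dil3 dil3_apply)
open Summit.QuantumFields.YangMills.Theorems.SwapVirialDeficit.BlowUp (leaderTuple dil3_one' dilateIm_one_apply)
open Summit.QuantumFields.YangMills.Theorems.SwapVirialDeficit.BlowUpRing (gnoLetter gnoSign gnoLetter_eq gnoLetter_ne_zero)

namespace Summit.QuantumFields.YangMills.Theorems.SwapVirialDeficit.Gnomonic

/-! ## §1 The radial projection of an arbitrary affine line: translate to the foot of the perpendicular -/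

/-- The foot of the perpendicular is orthogonal to the direction: `⟪u₀ − (⟪u₀,w⟫/‖w‖²) w, w⟫ = 0` (also for `w = 0`). [folklore] -/
theorem inner_foot_eq_zero (u₀ w : ℍ) : ⟪u₀ + (-(⟪u₀, w⟫ / ‖w‖ ^ 2)) • w, w⟫ = 0 := by
  rw [inner_add_left, real_inner_smul_left, real_inner_self_eq_norm_sq]
  by_cases hw : w = 0
  · simp [hw]
  · have h : ‖w‖ ^ 2 ≠ 0 := pow_ne_zero 2 (norm_ne_zero_iff.2 hw)
    field_simp
    ring

/-- The line through the foot: `u₀ + s w = u₀′ + (s − s₀) w`. [folklore] -/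
theorem affine_eq_foot_add (u₀ w : ℍ) (s : ℝ) :
    u₀ + s • w = (u₀ + (-(⟪u₀, w⟫ / ‖w‖ ^ 2)) • w) + (s - (-(⟪u₀, w⟫ / ‖w‖ ^ 2))) • w := by
  rw [sub_smul, add_assoc, add_sub_cancel]

/-- ★★ **THE RADIAL PROJECTION OF AN AFFINE LINE AVOIDING THE ORIGIN CARRIES A 4-JET OF SIZE `‖w‖/‖u₀′‖`**, `u₀′ = u₀ − (⟪u₀,w⟫/‖w‖²)w` the foot of the
perpendicular (assumed `≠ 0`): translate ✓`jet4_radialUnit_affine` by `s₀ = −⟪u₀,w⟫/‖w‖²`. [folklore] -/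
theorem jet4_radialUnit_line {u₀ w : ℍ} (h0 : u₀ + (-(⟪u₀, w⟫ / ‖w‖ ^ 2)) • w ≠ 0) :
    ∃ f₁ f₂ f₃ f₄ : ℝ → ℍ, (∀ s, HasDerivAt (fun s : ℝ => radialUnit (u₀ + s • w)) (f₁ s) s) ∧ (∀ s, HasDerivAt f₁ (f₂ s) s) ∧
      (∀ s, HasDerivAt f₂ (f₃ s) s) ∧ (∀ s, HasDerivAt f₃ (f₄ s) s) ∧
      ∀ s, ‖radialUnit (u₀ + s • w)‖ ≤ 1 ∧ ‖f₁ s‖ ≤ ‖w‖ / ‖u₀ + (-(⟪u₀, w⟫ / ‖w‖ ^ 2)) • w‖ ∧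
        ‖f₂ s‖ ≤ (‖w‖ / ‖u₀ + (-(⟪u₀, w⟫ / ‖w‖ ^ 2)) • w‖) ^ 2 ∧ ‖f₃ s‖ ≤ 3 * (‖w‖ / ‖u₀ + (-(⟪u₀, w⟫ / ‖w‖ ^ 2)) • w‖) ^ 3 ∧
        ‖f₄ s‖ ≤ 9 * (‖w‖ / ‖u₀ + (-(⟪u₀, w⟫ / ‖w‖ ^ 2)) • w‖) ^ 4 := by
  set c : ℝ := -(⟪u₀, w⟫ / ‖w‖ ^ 2) with hc
  obtain ⟨g₁, g₂, g₃, g₄, h₁, h₂, h₃, h₄, hb⟩ := jet4_radialUnit_affine h0 (inner_foot_eq_zero u₀ w)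
  have hsh : ∀ s : ℝ, HasDerivAt (fun s : ℝ => s - c) 1 s := fun s => (hasDerivAt_id' s).sub_const c
  have e : ∀ s : ℝ, radialUnit ((u₀ + c • w) + (s - c) • w) = radialUnit (u₀ + s • w) := fun s => by rw [← affine_eq_foot_add]
  refine ⟨fun s => g₁ (s - c), fun s => g₂ (s - c), fun s => g₃ (s - c), fun s => g₄ (s - c), fun s => ?_, fun s => ?_, fun s => ?_, fun s => ?_,
    fun s => ?_⟩
  · have h := (h₁ (s - c)).scomp s (hsh s)
    simp only [one_smul, Function.comp_def] at h
    refine HasDerivAt.congr_of_eventuallyEq h (Filter.Eventually.of_forall fun x => ?_)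
    exact (e x).symm
  · have h := (h₂ (s - c)).scomp s (hsh s)
    simpa only [one_smul, Function.comp_def] using h
  · have h := (h₃ (s - c)).scomp s (hsh s)
    simpa only [one_smul, Function.comp_def] using h
  · have h := (h₄ (s - c)).scomp s (hsh s)
    simpa only [one_smul, Function.comp_def] using h
  · have hn : ‖radialUnit (u₀ + s • w)‖ ≤ 1 := by rw [← e s]; exact (hb (s - c)).1
    exact ⟨hn, (hb (s - c)).2.1, (hb (s - c)).2.2.1, (hb (s - c)).2.2.2.1, (hb (s - c)).2.2.2.2⟩

/-! ## §2 Gnomonic letters along arbitrary coordinate lines -/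

/-- `(1, v + s ξ) = (1, v) + s·((1, ξ) − 1)`. [folklore] -/
theorem gnomonicQuat_add_smul (v ξ : Fin 3 → ℝ) (s : ℝ) : gnomonicQuat (v + s • ξ) = gnomonicQuat v + s • (gnomonicQuat ξ - 1) := by
  ext <;> simp [gnomonicQuat]

/-- The foot of a gnomonic coordinate line has real part `1`, hence norm `≥ 1` and is non-zero. [folklore] -/
theorem one_le_norm_foot (v ξ : Fin 3 → ℝ) :
    1 ≤ ‖gnomonicQuat v + (-(⟪gnomonicQuat v, gnomonicQuat ξ - 1⟫ / ‖gnomonicQuat ξ - 1‖ ^ 2)) • (gnomonicQuat ξ - 1)‖ := by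
  have hre : (gnomonicQuat v + (-(⟪gnomonicQuat v, gnomonicQuat ξ - 1⟫ / ‖gnomonicQuat ξ - 1‖ ^ 2)) • (gnomonicQuat ξ - 1)).re = 1 := by
    simp [gnomonicQuat]
  have h := Literature.MathematicalPhysics.QuantumLattice.abs_re_le_norm
    (gnomonicQuat v + (-(⟪gnomonicQuat v, gnomonicQuat ξ - 1⟫ / ‖gnomonicQuat ξ - 1‖ ^ 2)) • (gnomonicQuat ξ - 1))
  rw [hre, abs_one] at h
  exact h

/-- The foot of a gnomonic coordinate line is non-zero. [folklore] -/
theorem foot_ne_zero (v ξ : Fin 3 → ℝ) :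
    gnomonicQuat v + (-(⟪gnomonicQuat v, gnomonicQuat ξ - 1⟫ / ‖gnomonicQuat ξ - 1‖ ^ 2)) • (gnomonicQuat ξ - 1) ≠ 0 := by
  intro h
  have h1 := one_le_norm_foot v ξ
  rw [h, norm_zero] at h1
  exact absurd h1 (by norm_num)

/-- ★★ **A GNOMONIC LETTER ALONG ANY COORDINATE LINE CARRIES A 4-JET OF SIZE `√(Σ ξᵢ²)`**: for every base point `v`, direction `ξ` and sign `ε`,
`s ↦ su2Quat (quatToSU2 (gnoLetter ε (v + s • ξ)))` has four derivatives with norms `≤ |ξ|, |ξ|², 3|ξ|³, 9|ξ|⁴` (the Euler rays of K3 are the lines through the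
axial point; here no orthogonality is assumed — the line keeps real part `±1`, so the foot has norm `≥ 1`). [folklore] -/
theorem jet4_gnoLetterLine (ε : Bool) (v ξ : Fin 3 → ℝ) :
    ∃ f₁ f₂ f₃ f₄ : ℝ → ℍ, (∀ s, HasDerivAt (fun s : ℝ => su2Quat (quatToSU2 (gnoLetter ε (v + s • ξ)))) (f₁ s) s) ∧ (∀ s, HasDerivAt f₁ (f₂ s) s) ∧
      (∀ s, HasDerivAt f₂ (f₃ s) s) ∧ (∀ s, HasDerivAt f₃ (f₄ s) s) ∧
      ∀ s, ‖su2Quat (quatToSU2 (gnoLetter ε (v + s • ξ)))‖ ≤ 1 ∧ ‖f₁ s‖ ≤ Real.sqrt (∑ i, ξ i ^ 2) ∧ ‖f₂ s‖ ≤ Real.sqrt (∑ i, ξ i ^ 2) ^ 2 ∧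
        ‖f₃ s‖ ≤ 3 * Real.sqrt (∑ i, ξ i ^ 2) ^ 3 ∧ ‖f₄ s‖ ≤ 9 * Real.sqrt (∑ i, ξ i ^ 2) ^ 4 := by
  set w : ℍ := gnomonicQuat ξ - 1 with hwdef
  set u₀' : ℍ := gnomonicQuat v + (-(⟪gnomonicQuat v, w⟫ / ‖w‖ ^ 2)) • w with hu₀'
  have hfoot : u₀' ≠ 0 := foot_ne_zero v ξ
  have h := jet4_smul (abs_gnoSign ε) (jet4_radialUnit_line (u₀ := gnomonicQuat v) (w := w) hfoot)
  -- the size `‖w‖/‖u₀′‖ ≤ ‖w‖ = √Σξᵢ²`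
  have hw : ‖w‖ = Real.sqrt (∑ i, ξ i ^ 2) := by rw [← norm_gnomonicQuat_sub_one ξ, norm_one, div_one]
  have hsize : ‖w‖ / ‖u₀'‖ ≤ Real.sqrt (∑ i, ξ i ^ 2) := by
    rw [← hw]
    exact div_le_self (norm_nonneg _) (one_le_norm_foot v ξ)
  have h' := jet4_mono (by positivity) hsize h
  have e : ∀ s : ℝ, gnoSign ε • radialUnit (gnomonicQuat v + s • w) = su2Quat (quatToSU2 (gnoLetter ε (v + s • ξ))) := fun s => by
    rw [gnoLetter_eq, su2Quat_quatToSU2_smul_gnomonicQuat (abs_gnoSign ε), gnomonicQuat_add_smul]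
  simpa only [e] using h'

/-! ## §3 Leaders and followers along arbitrary lines of `GnoCoord L` -/

/-- ★★ **The slaved letter along a coordinate line**: `s ↦ Ā·x̂(s)·A·ẑ(s)` with `x(s) = gnoLetter εx (vx + s ξx)`, `z(s) = gnoLetter εz (vz + s ξz)`, `‖A‖ = 1`,
carries a 4-jet of size `|ξx| + |ξz|`. [folklore] -/
theorem jet4_slavedLetter_line {A : ℍ} (hA : ‖A‖ = 1) (εx εz : Bool) (vx ξx vz ξz : Fin 3 → ℝ) :
    ∃ f₁ f₂ f₃ f₄ : ℝ → ℍ,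
      (∀ s, HasDerivAt (fun s : ℝ => su2Quat (quatToSU2 (slaveP A (gnoLetter εx (vx + s • ξx)) * gnoLetter εz (vz + s • ξz)))) (f₁ s) s) ∧
      (∀ s, HasDerivAt f₁ (f₂ s) s) ∧ (∀ s, HasDerivAt f₂ (f₃ s) s) ∧ (∀ s, HasDerivAt f₃ (f₄ s) s) ∧
      ∀ s, ‖su2Quat (quatToSU2 (slaveP A (gnoLetter εx (vx + s • ξx)) * gnoLetter εz (vz + s • ξz)))‖ ≤ 1 ∧
        ‖f₁ s‖ ≤ Real.sqrt (∑ i, ξx i ^ 2) + Real.sqrt (∑ i, ξz i ^ 2) ∧ ‖f₂ s‖ ≤ (Real.sqrt (∑ i, ξx i ^ 2) + Real.sqrt (∑ i, ξz i ^ 2)) ^ 2 ∧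
        ‖f₃ s‖ ≤ 3 * (Real.sqrt (∑ i, ξx i ^ 2) + Real.sqrt (∑ i, ξz i ^ 2)) ^ 3 ∧ ‖f₄ s‖ ≤ 9 * (Real.sqrt (∑ i, ξx i ^ 2) + Real.sqrt (∑ i, ξz i ^ 2)) ^ 4 := by
  have hτ : 0 ≤ Real.sqrt (∑ i, ξx i ^ 2) := Real.sqrt_nonneg _
  have hζ : 0 ≤ Real.sqrt (∑ i, ξz i ^ 2) := Real.sqrt_nonneg _
  have h1 := jet4_mul le_rfl hτ (jet4_const (star A) (by rw [Quaternion.norm_star, hA]) le_rfl) (jet4_gnoLetterLine εx vx ξx)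
  have h2 := jet4_mul (by positivity) le_rfl h1 (jet4_const A hA.le le_rfl)
  have h3 := jet4_mul (by positivity) hζ h2 (jet4_gnoLetterLine εz vz ξz)
  have e : ∀ s : ℝ, star A * su2Quat (quatToSU2 (gnoLetter εx (vx + s • ξx))) * A * su2Quat (quatToSU2 (gnoLetter εz (vz + s • ξz))) =
      su2Quat (quatToSU2 (slaveP A (gnoLetter εx (vx + s • ξx)) * gnoLetter εz (vz + s • ξz))) := fun s =>
    (su2Quat_quatToSU2_slaveP_mul hA (gnoLetter_ne_zero _ _) (gnoLetter_ne_zero _ _)).symm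
  simpa only [e, zero_add, add_zero] using h3

/-- ★★★ **LEADER JETS ALONG A LINE OF `GnoCoord L`**: for `a ≠ 0`, every leader `su2Quat ((blowUpPoint 1 (gnomonicPoint a ε (η + s • ξ))).1 μ)` carries,
as a function of `s`, a 4-jet of size `√Σ(ξ.1.1)ₖ² + √Σ(ξ.1.2)ₖ² + √Σ(ξ.2.1)ₖ²` — every base point `η`, every direction `ξ`. [folklore] -/
theorem jet4_leader_line {L : ℕ} {a : ℍ} (ha : a ≠ 0) (ε : BlowUpRing.GnoSign L) (η ξ : BlowUpRing.GnoCoord L) (μ : Fin 4) :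
    ∃ f₁ f₂ f₃ f₄ : ℝ → ℍ,
      (∀ s, HasDerivAt (fun s : ℝ => su2Quat ((BlowUpRing.blowUpPoint (L := L) 1 (BlowUpRing.gnomonicPoint a ε (η + s • ξ))).1 μ)) (f₁ s) s) ∧
      (∀ s, HasDerivAt f₁ (f₂ s) s) ∧ (∀ s, HasDerivAt f₂ (f₃ s) s) ∧ (∀ s, HasDerivAt f₃ (f₄ s) s) ∧
      ∀ s, ‖su2Quat ((BlowUpRing.blowUpPoint (L := L) 1 (BlowUpRing.gnomonicPoint a ε (η + s • ξ))).1 μ)‖ ≤ 1 ∧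
        ‖f₁ s‖ ≤ Real.sqrt (∑ k, ξ.1.1 k ^ 2) + Real.sqrt (∑ k, ξ.1.2 k ^ 2) + Real.sqrt (∑ k, ξ.2.1 k ^ 2) ∧
        ‖f₂ s‖ ≤ (Real.sqrt (∑ k, ξ.1.1 k ^ 2) + Real.sqrt (∑ k, ξ.1.2 k ^ 2) + Real.sqrt (∑ k, ξ.2.1 k ^ 2)) ^ 2 ∧
        ‖f₃ s‖ ≤ 3 * (Real.sqrt (∑ k, ξ.1.1 k ^ 2) + Real.sqrt (∑ k, ξ.1.2 k ^ 2) + Real.sqrt (∑ k, ξ.2.1 k ^ 2)) ^ 3 ∧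
        ‖f₄ s‖ ≤ 9 * (Real.sqrt (∑ k, ξ.1.1 k ^ 2) + Real.sqrt (∑ k, ξ.1.2 k ^ 2) + Real.sqrt (∑ k, ξ.2.1 k ^ 2)) ^ 4 := by
  have hx : 0 ≤ Real.sqrt (∑ k, ξ.1.1 k ^ 2) := Real.sqrt_nonneg _
  have hy : 0 ≤ Real.sqrt (∑ k, ξ.1.2 k ^ 2) := Real.sqrt_nonneg _
  have hz : 0 ≤ Real.sqrt (∑ k, ξ.2.1 k ^ 2) := Real.sqrt_nonneg _
  match μ with
  | ⟨0, _⟩ =>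
    have e : ∀ s : ℝ, su2Quat (quatToSU2 (gnoLetter ε.1.1 (η.1.1 + s • ξ.1.1))) =
        su2Quat ((BlowUpRing.blowUpPoint (L := L) 1 (BlowUpRing.gnomonicPoint a ε (η + s • ξ))).1 ⟨0, by omega⟩) := fun s => by
      show _ = su2Quat (leaderTuple a (dil3 1 (BlowUpRing.gnomonicPoint a ε (η + s • ξ)).2.1) 0)
      rw [(BlowUp.leaderTuple_apply _ _).1, dil3_one']; rfl
    have h := jet4_mono hx (show _ ≤ Real.sqrt (∑ k, ξ.1.1 k ^ 2) + Real.sqrt (∑ k, ξ.1.2 k ^ 2) + Real.sqrt (∑ k, ξ.2.1 k ^ 2) by linarith)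
      (jet4_gnoLetterLine ε.1.1 η.1.1 ξ.1.1)
    simpa only [e] using h
  | ⟨1, _⟩ =>
    have e : ∀ s : ℝ, su2Quat (quatToSU2 (slaveP (radialUnit (axisPoint a)) (gnoLetter ε.1.1 (η.1.1 + s • ξ.1.1)) * gnoLetter ε.2.1 (η.2.1 + s • ξ.2.1))) =
        su2Quat ((BlowUpRing.blowUpPoint (L := L) 1 (BlowUpRing.gnomonicPoint a ε (η + s • ξ))).1 ⟨1, by omega⟩) := fun s => by
      show _ = su2Quat (leaderTuple a (dil3 1 (BlowUpRing.gnomonicPoint a ε (η + s • ξ)).2.1) 1)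
      rw [(BlowUp.leaderTuple_apply _ _).2.1, dil3_one']; rfl
    have h := jet4_mono (add_nonneg hx hz) (show _ ≤ Real.sqrt (∑ k, ξ.1.1 k ^ 2) + Real.sqrt (∑ k, ξ.1.2 k ^ 2) + Real.sqrt (∑ k, ξ.2.1 k ^ 2) by
      linarith) (jet4_slavedLetter_line (norm_axisUnit ha) ε.1.1 ε.2.1 η.1.1 ξ.1.1 η.2.1 ξ.2.1)
    simpa only [e] using h
  | ⟨2, _⟩ =>
    have e : ∀ s : ℝ, su2Quat (quatToSU2 (gnoLetter ε.1.2 (η.1.2 + s • ξ.1.2))) =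
        su2Quat ((BlowUpRing.blowUpPoint (L := L) 1 (BlowUpRing.gnomonicPoint a ε (η + s • ξ))).1 ⟨2, by omega⟩) := fun s => by
      show _ = su2Quat (leaderTuple a (dil3 1 (BlowUpRing.gnomonicPoint a ε (η + s • ξ)).2.1) 2)
      rw [(BlowUp.leaderTuple_apply _ _).2.2.1, dil3_one']; rfl
    have h := jet4_mono hy (show _ ≤ Real.sqrt (∑ k, ξ.1.1 k ^ 2) + Real.sqrt (∑ k, ξ.1.2 k ^ 2) + Real.sqrt (∑ k, ξ.2.1 k ^ 2) by linarith)
      (jet4_gnoLetterLine ε.1.2 η.1.2 ξ.1.2)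
    simpa only [e] using h
  | ⟨3, _⟩ =>
    have e : ∀ s : ℝ, su2Quat ((BlowUpRing.blowUpPoint (L := L) 1 (BlowUpRing.gnomonicPoint a ε (η + s • ξ))).1 ⟨3, by omega⟩) = radialUnit (axisPoint a) :=
      fun s => by
        show su2Quat (leaderTuple a (dil3 1 (BlowUpRing.gnomonicPoint a ε (η + s • ξ)).2.1) 3) = _
        rw [(BlowUp.leaderTuple_apply _ _).2.2.2]; exact su2Quat_quatToSU2_axisUnit ha
    simp only [e]
    exact jet4_const (radialUnit (axisPoint a)) (norm_axisUnit ha).le (by positivity)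

/-- ★★ **FOLLOWER JETS ALONG A LINE OF `GnoCoord L`**: the follower `i` of `blowUpPoint 1 (gnomonicPoint a ε (η + s • ξ))` carries a 4-jet of size
`√Σ(ξ.2.2 i)ₖ²`. [folklore] -/
theorem jet4_follower_line {L : ℕ} (a : ℍ) (ε : BlowUpRing.GnoSign L) (η ξ : BlowUpRing.GnoCoord L) (i : BlowUpRing.Fol L) :
    ∃ f₁ f₂ f₃ f₄ : ℝ → ℍ,
      (∀ s, HasDerivAt (fun s : ℝ => su2Quat ((BlowUpRing.blowUpPoint (L := L) 1 (BlowUpRing.gnomonicPoint a ε (η + s • ξ))).2 i)) (f₁ s) s) ∧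
      (∀ s, HasDerivAt f₁ (f₂ s) s) ∧ (∀ s, HasDerivAt f₂ (f₃ s) s) ∧ (∀ s, HasDerivAt f₃ (f₄ s) s) ∧
      ∀ s, ‖su2Quat ((BlowUpRing.blowUpPoint (L := L) 1 (BlowUpRing.gnomonicPoint a ε (η + s • ξ))).2 i)‖ ≤ 1 ∧
        ‖f₁ s‖ ≤ Real.sqrt (∑ k, ξ.2.2 i k ^ 2) ∧ ‖f₂ s‖ ≤ Real.sqrt (∑ k, ξ.2.2 i k ^ 2) ^ 2 ∧ ‖f₃ s‖ ≤ 3 * Real.sqrt (∑ k, ξ.2.2 i k ^ 2) ^ 3 ∧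
        ‖f₄ s‖ ≤ 9 * Real.sqrt (∑ k, ξ.2.2 i k ^ 2) ^ 4 := by
  have e : ∀ s : ℝ, su2Quat (quatToSU2 (gnoLetter (ε.2.2 i) (η.2.2 i + s • ξ.2.2 i))) =
      su2Quat ((BlowUpRing.blowUpPoint (L := L) 1 (BlowUpRing.gnomonicPoint a ε (η + s • ξ))).2 i) := fun s => by
    show _ = su2Quat (quatToSU2 (ZeroModeSigma.dilateIm 1 (gnoLetter (ε.2.2 i) ((η + s • ξ).2.2 i))))
    rw [dilateIm_one_apply]; rfl
  have h := jet4_gnoLetterLine (ε.2.2 i) (η.2.2 i) (ξ.2.2 i)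
  simpa only [e] using h

end Summit.QuantumFields.YangMills.Theorems.SwapVirialDeficit.Gnomonic

end
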